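import Summits.SmoothPoincare4.SmoothPoincare4.Theorems.WeakReductionDescentDependentTripleGenusThreeStandardCornerFacesAux1
import Literature.Topology.FourManifolds.WeaklyReducibleTrisections
import Literature.Topology.FourManifolds.TrisectionsCentralSurfaceLocal
import Literature.Topology.FourManifolds.TrisectionSectorCollars
import Literature.Topology.FourManifolds.BallGluingCharts
import HarnessLib

/-!
# The two faces of a sector at a corner point, in a corner chart of the sector piece `W`

Helper file (`--supports stmt-SmoothPoincare4-18000`, registered helper `helper_cornerChart_faces`
of the skeleton `Cruxes/DependentTripleGenusThreeStandard/Lines/Sketch.lean`): the LOCAL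
STRUCTURE LEMMA at the corner of a Gay–Kirby sector, first brick of the smooth Heegaard structure
on the sector boundary `∂X_i` (Aranda–Zupan, Lemma 3.8) and of any re-trisection after a surgery.

Clause (ii) of the tree's predicate `IsGKTrisection M g k T` (`Trisections.lean`) presents the
sector `T i` as the image of a topological embedding `e : W → M` of a compact connected smooth
`4`-manifold with boundary `W`, a `C^∞` immersion off the central surface `F = ⋂ m, T m` and with
a corner chart (`IsCornerAt`: `ψ ∘ e ∘ φ⁻¹ = A ∘ cornerUnbend`) at every point over `F`.  We prove
(`helper_cornerChart_faces`): every `w` with `e w ∈ F` has a chart `φ` of the maximal `C^∞` atlas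
of `W`, `φ w = 0`, with `e w' ∈ H_j ↔ (φ w')₀ = 0 ∧ (φ w')₁ ≥ 0` and
`e w' ∈ H_l ↔ (φ w')₀ = 0 ∧ (φ w')₁ ≤ 0` for `w' ∈ φ.source` (`H_p = spineHandlebody T p`,
`{i, j, l} = {0, 1, 2}`).

Proof (Gay–Kirby's Fig. 1 read on the `W` side).  In the corner chart `φ₀` at `w`:
(a) `(φ₀ w')₀ = 0 ↔ w' ∈ ∂W` (boundary invariance for the maximal atlas,
`isBoundaryPoint_iff_of_mem_maximalAtlas`) `↔ e w' ∈ T j ∪ T l` (`IsGKTrisection.image_boundary_eq`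
and the clause `T i ∩ T m ⊆ e(∂W)`); (b) `e w' ∈ F ↔ (φ₀ w')₀ = (φ₀ w')₁ = 0` (the central surface
is the corner stratum: `stratum_of_isCornerAt`, `not_stratum_of_isImmersionAt`).  Shrink `φ₀` to
`φ₁` with round source (`exists_chart_roundSource`); the open face pieces `P = {x₀ = 0 < x₁}`,
`N = {x₀ = 0 > x₁}` of `φ₁.source` are preconnected (`isPreconnected_facePiece`), covered by the
closed sets `e⁻¹(T l)`, `e⁻¹(T j)` which meet them only over `F` = the stratum, so each lies in
one of them — and not both in the same one, for then `T i ∩ T j` (or `T i ∩ T l`) would lie in `F`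
near `e w` (`IsGKTrisection.not_inter_inter_subset_iInter`, clause (iii)).  If `P ⊆ e⁻¹(T j)` the
chart is reflected across `{x₁ = 0}` (`helper_exists_chart_reflect`, Aux 1).  Everything is
proved; no definitions, no named facts.

References: D. Gay, R. Kirby, *Trisecting 4-manifolds*, Geom. Topol. 20 (2016), Def. 1 and
Fig. 1; A. Douady, Sém. H. Cartan 14 (1961/62), §1, §4; J. M. Lee, *Introduction to Smooth
Manifolds* (2013), Thm. 1.46; R. Aranda, A. Zupan, arXiv:2503.04607 (2025), Lemma 3.8.
-/

-- the registered namespace `Summit.SmoothPoincare4.SmoothPoincare4.Theorems…` repeats a component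
set_option linter.dupNamespace false

noncomputable section

open scoped Manifold ContDiff Topology
open Set Function
open Literature.Topology.FourManifolds Literature.Topology.FourManifolds.Trisection

namespace Summit.SmoothPoincare4.SmoothPoincare4.Theorems

/-! ### Elementary pieces -/

/-- **The face dichotomy, pointwise.**  If (A) "in `H_j` or in `H_l`" means `a = 0`, (B) "in
both" means `a = 0 ∧ b = 0`, (C) `a = 0 < b` forces `H_j` and (D) `a = 0 > b` forces `H_l`, then
`H_j ↔ a = 0 ∧ 0 ≤ b` and `H_l ↔ a = 0 ∧ b ≤ 0`. [folklore] -/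
theorem cornerFaces_logic {pj pl : Prop} {a b : ℝ} (hA : (pj ∨ pl) ↔ a = 0)
    (hB : (pj ∧ pl) ↔ (a = 0 ∧ b = 0)) (hC : a = 0 → 0 < b → pj) (hD : a = 0 → b < 0 → pl) :
    (pj ↔ (a = 0 ∧ 0 ≤ b)) ∧ (pl ↔ (a = 0 ∧ b ≤ 0)) := by
  refine ⟨⟨fun h => ?_, ?_⟩, ⟨fun h => ?_, ?_⟩⟩
  · have ha : a = 0 := hA.1 (Or.inl h)
    refine ⟨ha, not_lt.1 fun hb => ?_⟩
    exact absurd (hB.1 ⟨h, hD ha hb⟩).2 hb.ne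
  · rintro ⟨ha, hb⟩
    rcases hb.lt_or_eq with hb | hb
    · exact hC ha hb
    · exact (hB.2 ⟨ha, hb.symm⟩).1
  · have ha : a = 0 := hA.1 (Or.inr h)
    refine ⟨ha, not_lt.1 fun hb => ?_⟩
    exact absurd (hB.1 ⟨hC ha hb, h⟩).2 hb.ne'
  · rintro ⟨ha, hb⟩
    rcases hb.lt_or_eq with hb | hb
    · exact hD ha hb
    · exact (hB.2 ⟨ha, hb⟩).2

section Charts

variable {W : Type} [TopologicalSpace W] [ChartedSpace (EuclideanHalfSpace 4) W]

/-- **Shrinking a boundary chart to a round target.**  A chart `φ` of the maximal `C^∞` atlas with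
`φ w = 0` restricts (`restr_mem_maximalAtlas`) to a chart of the maximal atlas at `w` whose source
is `{w' ∈ φ.source | ‖φ w'‖ < ε}`, where the half-ball `{‖y‖ < ε}` of the half-space lies in
`φ.target`. [cite: LeeSmoothManifolds2013, Prop. 1.17] -/
theorem exists_chart_roundSource {φ : OpenPartialHomeomorph W (EuclideanHalfSpace 4)}
    (hφ : φ ∈ IsManifold.maximalAtlas (𝓡∂ 4) ∞ W) {w : W} (hw : w ∈ φ.source)
    (hw0 : (φ w).val = 0) :
    ∃ (φ' : OpenPartialHomeomorph W (EuclideanHalfSpace 4)) (ε : ℝ), 0 < ε ∧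
      φ' ∈ IsManifold.maximalAtlas (𝓡∂ 4) ∞ W ∧ w ∈ φ'.source ∧
      φ'.source = φ.source ∩ {w' | ‖(φ w').val‖ < ε} ∧ (∀ w', φ' w' = φ w') ∧
      {y : EuclideanHalfSpace 4 | ‖y.val‖ < ε} ⊆ φ.target := by
  -- a round ball inside the open set `(𝓡∂ 4)⁻¹(φ.target)` around `0`
  have hU : IsOpen ((𝓡∂ 4).symm ⁻¹' φ.target : Set (EuclideanSpace ℝ (Fin 4))) :=
    φ.open_target.preimage (𝓡∂ 4).continuous_symm
  have hsymm0 : (𝓡∂ 4).symm (0 : EuclideanSpace ℝ (Fin 4)) = φ w := by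
    rw [← hw0]
    exact (𝓡∂ 4).left_inv (φ w)
  have h0U : (0 : EuclideanSpace ℝ (Fin 4)) ∈ ((𝓡∂ 4).symm ⁻¹' φ.target : Set _) := by
    rw [mem_preimage, hsymm0]
    exact φ.map_source hw
  obtain ⟨ε, hε, hball⟩ := Metric.isOpen_iff.mp hU 0 h0U
  set V : Set (EuclideanHalfSpace 4) :=
    Subtype.val ⁻¹' Metric.ball (0 : EuclideanSpace ℝ (Fin 4)) ε with hV
  have hVopen : IsOpen V := Metric.isOpen_ball.preimage continuous_subtype_val
  have hVt : V ⊆ φ.target := by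
    intro y hy
    have hyy : (𝓡∂ 4).symm y.val = y := (𝓡∂ 4).left_inv y
    have := hball hy
    rw [mem_preimage, hyy] at this
    exact this
  set s : Set W := φ.source ∩ φ ⁻¹' V with hs
  have hsopen : IsOpen s := φ.isOpen_inter_preimage hVopen
  refine ⟨φ.restr s, ε, hε, restr_mem_maximalAtlas (contDiffGroupoid ∞ (𝓡∂ 4)) hφ hsopen, ?_, ?_,
    fun w' => rfl, fun y hy => hVt (mem_ball_zero_iff.2 hy)⟩
  · rw [φ.restr_source' s hsopen]
    refine ⟨hw, hw, ?_⟩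
    show (φ w).val ∈ Metric.ball (0 : EuclideanSpace ℝ (Fin 4)) ε
    rw [hw0]
    exact Metric.mem_ball_self hε
  · rw [φ.restr_source' s hsopen, hs, ← inter_assoc, inter_self]
    congr 1
    ext w'
    exact mem_ball_zero_iff

omit [ChartedSpace (EuclideanHalfSpace 4) W] in
/-- **Face pieces over a round chart target are preconnected**: for a convex
`C ⊆ {x₀ ≥ 0, ‖x‖ < ε}` with `{‖y‖ < ε} ⊆ φ.target`, the set `{w' ∈ φ.source | φ w' ∈ C}` is
the image of `C` under the (continuous) inverse extended chart. [folklore] -/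
theorem isPreconnected_facePiece (φ : OpenPartialHomeomorph W (EuclideanHalfSpace 4)) {ε : ℝ}
    (hVt : {y : EuclideanHalfSpace 4 | ‖y.val‖ < ε} ⊆ φ.target)
    {C : Set (EuclideanSpace ℝ (Fin 4))} (hC : Convex ℝ C)
    (hCsub : C ⊆ {x | 0 ≤ x 0 ∧ ‖x‖ < ε}) :
    IsPreconnected {w' ∈ φ.source | (φ w').val ∈ C} := by
  have hCt : C ⊆ (φ.extend (𝓡∂ 4)).target := by
    intro x hx
    obtain ⟨hx0, hxε⟩ := hCsub hx
    have hxr : x ∈ range (𝓡∂ 4) := by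
      rw [range_modelWithCornersEuclideanHalfSpace]
      exact hx0
    rw [OpenPartialHomeomorph.extend_target]
    refine ⟨?_, hxr⟩
    rw [mem_preimage]
    apply hVt
    show ‖((𝓡∂ 4).symm x).val‖ < ε
    rw [show ((𝓡∂ 4).symm x).val = (𝓡∂ 4) ((𝓡∂ 4).symm x) from rfl, (𝓡∂ 4).right_inv hxr]
    exact hxε
  have himg : {w' ∈ φ.source | (φ w').val ∈ C} = (φ.extend (𝓡∂ 4)).symm '' C := by
    apply Subset.antisymm
    · rintro w' ⟨hw', hC'⟩
      exact ⟨(φ w').val, hC', (φ.extend (𝓡∂ 4)).left_inv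
        (by rwa [OpenPartialHomeomorph.extend_source])⟩
    · rintro _ ⟨x, hx, rfl⟩
      have hxt := hCt hx
      have hsrc : (φ.extend (𝓡∂ 4)).symm x ∈ φ.source := by
        have := (φ.extend (𝓡∂ 4)).map_target hxt
        rwa [OpenPartialHomeomorph.extend_source] at this
      have hval : (φ ((φ.extend (𝓡∂ 4)).symm x)).val = x := (φ.extend (𝓡∂ 4)).right_inv hxt
      refine ⟨hsrc, ?_⟩
      show (φ ((φ.extend (𝓡∂ 4)).symm x)).val ∈ C
      rw [hval]
      exact hx
  rw [himg]
  exact hC.isPreconnected.image _ ((φ.continuousOn_extend_symm (I := 𝓡∂ 4)).mono hCt)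

end Charts

/-! ### The registered helper -/

/-- **The two faces of a sector at a corner point (local structure lemma at the corner of a
Gay–Kirby sector).**  Let `T` be a Gay–Kirby trisection of `M`, `{i, j, l} = {0, 1, 2}`, and let
`e : W → M` present the sector `T i` as in clause (ii) of `IsGKTrisection` (the hypotheses after
`IsGKTrisection M g k T →` are verbatim its components: `W` compact connected, `e` a topological
embedding onto `T i`, a `C^∞` immersion off `F = ⋂ m, T m`, with a corner chart at every point
over `F`, and `T i ∩ T m ⊆ e(∂W)` for `m ≠ i`).  Then every `w` with `e w ∈ F` lies in the source
of a chart `φ` of the maximal `C^∞` atlas of `W` with `φ w = 0` in which, for `w' ∈ φ.source`,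
`e w' ∈ H_j ↔ (φ w')₀ = 0 ∧ 0 ≤ (φ w')₁` and `e w' ∈ H_l ↔ (φ w')₀ = 0 ∧ (φ w')₁ ≤ 0`
(`H_p = Trisection.spineHandlebody T p`): the two handlebodies of the spine adjacent to the
sector are the two linear faces `{x₀ = 0, ±x₁ ≥ 0}` of the boundary of the half-space, meeting
along the stratum `{x₀ = x₁ = 0} = φ(e⁻¹ F)` (Gay–Kirby's Fig. 1 read in the sector piece; proof
in the module docstring). [cite: GayKirby2016, Def. 1 and Fig. 1] -/
theorem helper_cornerChart_faces :
    ∀ (M : Type) [TopologicalSpace M] [T2Space M] [SecondCountableTopology M]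
      [ChartedSpace (EuclideanSpace ℝ (Fin 4)) M] [IsManifold (𝓡 4) ∞ M],
      ∀ (g : ℕ) (k : Fin 3 → ℕ) (T : Fin 3 → Set M), IsGKTrisection M g k T →
      ∀ (i j l : Fin 3), i ≠ j → j ≠ l → i ≠ l →
      ∀ (W : Type) [TopologicalSpace W] [ChartedSpace (EuclideanHalfSpace 4) W] [IsManifold (𝓡∂ 4) ∞ W]
      (e : W → M), CompactSpace W → ConnectedSpace W →
      Topology.IsEmbedding e → range e = T i →
      (∀ w, e w ∉ (⋂ m, T m) → Manifold.IsImmersionAt (𝓡∂ 4) (𝓡 4) ∞ e w) →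
      (∀ w, e w ∈ (⋂ m, T m) → IsCornerAt e w) →
      (∀ m, m ≠ i → T i ∩ T m ⊆ e '' (𝓡∂ 4).boundary W) →
      ∀ w, e w ∈ (⋂ m, T m) →
      ∃ φ : OpenPartialHomeomorph W (EuclideanHalfSpace 4),
        φ ∈ IsManifold.maximalAtlas (𝓡∂ 4) ∞ W ∧ w ∈ φ.source ∧ (φ w).val = 0 ∧
        (∀ w' ∈ φ.source, e w' ∈ spineHandlebody T j ↔ ((φ w').val 0 = 0 ∧ 0 ≤ (φ w').val 1)) ∧
        (∀ w' ∈ φ.source, e w' ∈ spineHandlebody T l ↔ ((φ w').val 0 = 0 ∧ (φ w').val 1 ≤ 0)) := by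
  intro M _ _ _ _ _ g k T hT i j l hij hjl hil W _ _ _ e _ _ he hrange himm hcorner hbdry w hw
  have hcov : ∀ m : Fin 3, m = i ∨ m = j ∨ m = l := by
    have h3 : ∀ i j l : Fin 3, i ≠ j → j ≠ l → i ≠ l → ∀ m : Fin 3, m = i ∨ m = j ∨ m = l := by
      decide
    exact h3 i j l hij hjl hil
  -- every point of `W` maps into the sector `T i`
  have hTi : ∀ w', e w' ∈ T i := fun w' => hrange ▸ mem_range_self w'
  -- over `T i`: the central surface is `T l ∩ T j`, and `H_j = T l`, `H_l = T j`
  have hF_iff : ∀ w', e w' ∈ (⋂ m, T m) ↔ (e w' ∈ T l ∧ e w' ∈ T j) := by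
    intro w'
    simp only [mem_iInter]
    refine ⟨fun h => ⟨h l, h j⟩, fun h m => ?_⟩
    rcases hcov m with rfl | rfl | rfl
    exacts [hTi w', h.2, h.1]
  have hHj : ∀ w', e w' ∈ spineHandlebody T j ↔ e w' ∈ T l := by
    intro w'
    simp only [spineHandlebody, mem_iInter]
    refine ⟨fun h => h l hjl.symm, fun h m hm => ?_⟩
    rcases hcov m with rfl | rfl | rfl
    exacts [hTi w', absurd rfl hm, h]
  have hHl : ∀ w', e w' ∈ spineHandlebody T l ↔ e w' ∈ T j := by
    intro w'
    simp only [spineHandlebody, mem_iInter]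
    refine ⟨fun h => h j hjl, fun h m hm => ?_⟩
    rcases hcov m with rfl | rfl | rfl
    exacts [hTi w', h, absurd rfl hm]
  -- STEP 1: the corner chart at `w`
  obtain ⟨φ₀, ψ, A, hφ₀, hψ, hwφ₀, hsrc, hw0, heq⟩ := (hcorner w hw).exists_eqOn
  -- (a) the boundary coordinate: `x₀ = 0 ↔ w' ∈ ∂W ↔ e w' ∈ T l ∪ T j`
  have hA : ∀ w' ∈ φ₀.source, (e w' ∈ T l ∨ e w' ∈ T j) ↔ (φ₀ w').val 0 = 0 := by
    intro w' hw'
    have hbd : (𝓡∂ 4).IsBoundaryPoint w' ↔ (φ₀ w').val 0 = 0 := by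
      rw [isBoundaryPoint_iff_of_mem_maximalAtlas (I := 𝓡∂ 4) (m := ∞) (by simp) hφ₀ hw',
        frontier_range_modelWithCornersEuclideanHalfSpace]
      exact eq_comm
    rw [← hbd]
    constructor
    · have key : ∀ m, m ≠ i → e w' ∈ T m → (𝓡∂ 4).IsBoundaryPoint w' := by
        intro m hm hwm
        obtain ⟨w'', hw'', hee⟩ := hbdry m hm ⟨hTi w', hwm⟩
        rwa [← he.injective hee]
      rintro (h | h)
      exacts [key l hil.symm h, key j hij.symm h]
    · intro h
      have hmem : e w' ∈ e '' (𝓡∂ 4).boundary W := mem_image_of_mem e h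
      rw [hT.image_boundary_eq he hrange hbdry] at hmem
      obtain ⟨hn1, hn2, -⟩ := fin3_succ_ne i
      have key : ∀ m, m ≠ i → e w' ∈ T m → (e w' ∈ T l ∨ e w' ∈ T j) := by
        intro m hm hwm
        rcases hcov m with rfl | rfl | rfl
        exacts [absurd rfl hm, Or.inr hwm, Or.inl hwm]
      rcases hmem.2 with h1 | h2
      exacts [key _ hn1 h1, key _ hn2 h2]
  -- (b) the stratum: `e w' ∈ F ↔ x₀ = x₁ = 0`
  have hB : ∀ w' ∈ φ₀.source,
      (e w' ∈ T l ∧ e w' ∈ T j) ↔ ((φ₀ w').val 0 = 0 ∧ (φ₀ w').val 1 = 0) := by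
    intro w' hw'
    rw [← hF_iff]
    constructor
    · intro hF
      exact stratum_of_isCornerAt hφ₀ hψ hsrc heq hw' (hcorner w' hF)
    · intro h
      by_contra hF
      exact not_stratum_of_isImmersionAt hφ₀ hψ hsrc heq hw' (himm w' hF) h
  -- STEP 2: shrink the chart to a round target
  obtain ⟨φ₁, ε, hε, hφ₁, hwφ₁, hsource, hcoe, hVt⟩ := exists_chart_roundSource hφ₀ hwφ₀ hw0
  have hsub : φ₁.source ⊆ φ₀.source := hsource ▸ inter_subset_left
  have hsource' : ∀ w', w' ∈ φ₁.source ↔ w' ∈ φ₀.source ∧ ‖(φ₀ w').val‖ < ε := fun w' => by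
    rw [hsource]; rfl
  -- an open set of `M` cutting `φ₁.source` out of `W`
  obtain ⟨O, hO, hOeq⟩ := he.isOpen_iff.mp φ₁.open_source
  have hON : O ∈ 𝓝 (e w) := hO.mem_nhds (by rw [← mem_preimage, hOeq]; exact hwφ₁)
  -- STEP 3: the two open face pieces over the round target
  have hlin0 : IsLinearMap ℝ fun q : EuclideanSpace ℝ (Fin 4) => q 0 :=
    (EuclideanSpace.proj (0 : Fin 4)).isLinear
  have hlin1 : IsLinearMap ℝ fun q : EuclideanSpace ℝ (Fin 4) => q 1 :=
    (EuclideanSpace.proj (1 : Fin 4)).isLinear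
  set Cp : Set (EuclideanSpace ℝ (Fin 4)) :=
    {x | x ∈ Metric.ball (0 : EuclideanSpace ℝ (Fin 4)) ε ∧ x 0 = 0 ∧ 0 < x 1} with hCp
  set Cn : Set (EuclideanSpace ℝ (Fin 4)) :=
    {x | x ∈ Metric.ball (0 : EuclideanSpace ℝ (Fin 4)) ε ∧ x 0 = 0 ∧ x 1 < 0} with hCn
  have hCpc : Convex ℝ Cp :=
    (convex_ball _ _).inter ((convex_hyperplane hlin0 0).inter (convex_halfSpace_gt hlin1 0))
  have hCnc : Convex ℝ Cn :=
    (convex_ball _ _).inter ((convex_hyperplane hlin0 0).inter (convex_halfSpace_lt hlin1 0))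
  have hCpsub : Cp ⊆ {x | 0 ≤ x 0 ∧ ‖x‖ < ε} := fun x hx =>
    ⟨le_of_eq (Eq.symm hx.2.1), mem_ball_zero_iff.1 hx.1⟩
  have hCnsub : Cn ⊆ {x | 0 ≤ x 0 ∧ ‖x‖ < ε} := fun x hx =>
    ⟨le_of_eq (Eq.symm hx.2.1), mem_ball_zero_iff.1 hx.1⟩
  set P : Set W := {w' ∈ φ₀.source | (φ₀ w').val ∈ Cp} with hP
  set N : Set W := {w' ∈ φ₀.source | (φ₀ w').val ∈ Cn} with hN
  have hPconn : IsPreconnected P := isPreconnected_facePiece φ₀ hVt hCpc hCpsub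
  have hNconn : IsPreconnected N := isPreconnected_facePiece φ₀ hVt hCnc hCnsub
  have hP_iff : ∀ w', w' ∈ P ↔ w' ∈ φ₁.source ∧ (φ₀ w').val 0 = 0 ∧ 0 < (φ₀ w').val 1 := by
    intro w'
    rw [hsource', hP, mem_sep_iff, hCp, mem_setOf_eq, mem_ball_zero_iff, and_assoc]
  have hN_iff : ∀ w', w' ∈ N ↔ w' ∈ φ₁.source ∧ (φ₀ w').val 0 = 0 ∧ (φ₀ w').val 1 < 0 := by
    intro w'
    rw [hsource', hN, mem_sep_iff, hCn, mem_setOf_eq, mem_ball_zero_iff, and_assoc]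
  -- each face piece lies in one of the closed sets `e⁻¹(T l)`, `e⁻¹(T j)`
  have hclosed : ∀ m, IsClosed (e ⁻¹' T m) := fun m => (hT.isClosed m).preimage he.continuous
  have hface : ∀ Q : Set W, IsPreconnected Q → Q ⊆ φ₀.source →
      (∀ w' ∈ Q, (φ₀ w').val 0 = 0 ∧ (φ₀ w').val 1 ≠ 0) →
      Q ⊆ e ⁻¹' T l ∨ Q ⊆ e ⁻¹' T j := by
    intro Q hQ hQs hQf
    refine isPreconnected_iff_subset_of_disjoint_closed.mp hQ _ _ (hclosed l) (hclosed j) ?_ ?_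
    · intro w' hw'
      exact (hA w' (hQs hw')).2 (hQf w' hw').1
    · rw [eq_empty_iff_forall_notMem]
      rintro w' ⟨hw', h1, h2⟩
      exact (hQf w' hw').2 ((hB w' (hQs hw')).1 ⟨h1, h2⟩).2
  have hPs : P ⊆ φ₀.source := fun w' hw' => hw'.1
  have hNs : N ⊆ φ₀.source := fun w' hw' => hw'.1
  have hPf : ∀ w' ∈ P, (φ₀ w').val 0 = 0 ∧ (φ₀ w').val 1 ≠ 0 := fun w' hw' =>
    ⟨((hP_iff w').1 hw').2.1, ne_of_gt ((hP_iff w').1 hw').2.2⟩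
  have hNf : ∀ w' ∈ N, (φ₀ w').val 0 = 0 ∧ (φ₀ w').val 1 ≠ 0 := fun w' hw' =>
    ⟨((hN_iff w').1 hw').2.1, ne_of_lt ((hN_iff w').1 hw').2.2⟩
  -- … but not both in the same one: else `T i ∩ T m' ∩ O ⊆ F` for the other sector `T m'`
  have hnot : ∀ m m' : Fin 3, m' ≠ i → (∀ w', e w' ∈ T m → e w' ∈ T m' → e w' ∈ ⋂ n, T n) →
      (∀ w' ∈ φ₀.source, e w' ∈ T m' → (φ₀ w').val 0 = 0) →
      (∀ w' ∈ φ₀.source, (φ₀ w').val 0 = 0 → (φ₀ w').val 1 = 0 → e w' ∈ T m) →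
      ¬ (P ⊆ e ⁻¹' T m ∧ N ⊆ e ⁻¹' T m) := by
    rintro m m' hm'i hFm hbm hsm ⟨hPm, hNm⟩
    apply hT.not_inter_inter_subset_iInter hm'i.symm hw hON
    rintro y ⟨⟨hyi, hym'⟩, hyO⟩
    rw [← hrange] at hyi
    obtain ⟨w', rfl⟩ := hyi
    have hw'1 : w' ∈ φ₁.source := by
      rw [← hOeq]
      exact hyO
    have hw'0 : w' ∈ φ₀.source := hsub hw'1
    refine hFm w' ?_ hym'
    have h0 : (φ₀ w').val 0 = 0 := hbm w' hw'0 hym'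
    rcases lt_trichotomy ((φ₀ w').val 1) 0 with h1 | h1 | h1
    · exact hNm ((hN_iff w').2 ⟨hw'1, h0, h1⟩)
    · exact hsm w' hw'0 h0 h1
    · exact hPm ((hP_iff w').2 ⟨hw'1, h0, h1⟩)
  have hnot_l : ¬ (P ⊆ e ⁻¹' T l ∧ N ⊆ e ⁻¹' T l) :=
    hnot l j hij.symm (fun w' h1 h2 => (hF_iff w').2 ⟨h1, h2⟩)
      (fun w' hw' h => (hA w' hw').1 (Or.inr h)) (fun w' hw' h0 h1 => ((hB w' hw').2 ⟨h0, h1⟩).1)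
  have hnot_j : ¬ (P ⊆ e ⁻¹' T j ∧ N ⊆ e ⁻¹' T j) :=
    hnot j l hil.symm (fun w' h1 h2 => (hF_iff w').2 ⟨h2, h1⟩)
      (fun w' hw' h => (hA w' hw').1 (Or.inl h)) (fun w' hw' h0 h1 => ((hB w' hw').2 ⟨h0, h1⟩).2)
  -- STEP 4: conclude, reflecting the chart if the faces come in the wrong order
  rcases hface P hPconn hPs hPf with hPl | hPj <;> rcases hface N hNconn hNs hNf with hNl | hNj
  · exact absurd ⟨hPl, hNl⟩ hnot_l
  · -- `P ⊆ e⁻¹(T l) = e⁻¹(H_j)`, `N ⊆ e⁻¹(T j) = e⁻¹(H_l)`: the chart `φ₁` does it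
    refine ⟨φ₁, hφ₁, hwφ₁, by rw [hcoe]; exact hw0, fun w' hw' => ?_, fun w' hw' => ?_⟩
    · rw [hHj, hcoe]
      exact (cornerFaces_logic (hA w' (hsub hw')) (hB w' (hsub hw'))
        (fun h0 h1 => hPl ((hP_iff w').2 ⟨hw', h0, h1⟩))
        (fun h0 h1 => hNj ((hN_iff w').2 ⟨hw', h0, h1⟩))).1
    · rw [hHl, hcoe]
      exact (cornerFaces_logic (hA w' (hsub hw')) (hB w' (hsub hw'))
        (fun h0 h1 => hPl ((hP_iff w').2 ⟨hw', h0, h1⟩))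
        (fun h0 h1 => hNj ((hN_iff w').2 ⟨hw', h0, h1⟩))).2
  · -- `P ⊆ e⁻¹(T j)`, `N ⊆ e⁻¹(T l)`: reflect `φ₁` across `{x₁ = 0}`
    obtain ⟨φ₂, hφ₂, hsrc₂, hval⟩ := helper_exists_chart_reflect W φ₁ hφ₁
    have hA' : ∀ w' ∈ φ₂.source, (e w' ∈ T l ∨ e w' ∈ T j) ↔ (φ₂ w').val 0 = 0 := by
      intro w' hw'
      rw [hsrc₂] at hw'
      rw [(hval w').1, hcoe]
      exact hA w' (hsub hw')
    have hB' : ∀ w' ∈ φ₂.source,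
        (e w' ∈ T l ∧ e w' ∈ T j) ↔ ((φ₂ w').val 0 = 0 ∧ (φ₂ w').val 1 = 0) := by
      intro w' hw'
      rw [hsrc₂] at hw'
      rw [(hval w').1, (hval w').2.1, hcoe, neg_eq_zero]
      exact hB w' (hsub hw')
    have hC' : ∀ w' ∈ φ₂.source, (φ₂ w').val 0 = 0 → 0 < (φ₂ w').val 1 → e w' ∈ T l := by
      intro w' hw'
      rw [hsrc₂] at hw'
      rw [(hval w').1, (hval w').2.1, hcoe, neg_pos]
      exact fun h0 h1 => hNl ((hN_iff w').2 ⟨hw', h0, h1⟩)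
    have hD' : ∀ w' ∈ φ₂.source, (φ₂ w').val 0 = 0 → (φ₂ w').val 1 < 0 → e w' ∈ T j := by
      intro w' hw'
      rw [hsrc₂] at hw'
      rw [(hval w').1, (hval w').2.1, hcoe, neg_lt_zero]
      exact fun h0 h1 => hPj ((hP_iff w').2 ⟨hw', h0, h1⟩)
    refine ⟨φ₂, hφ₂, hsrc₂ ▸ hwφ₁, ?_, fun w' hw' => ?_, fun w' hw' => ?_⟩
    · have h0 : (φ₁ w).val = 0 := by rw [hcoe]; exact hw0
      ext m
      fin_cases m
      · show (φ₂ w).val 0 = 0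
        rw [(hval w).1, h0]
        rfl
      · show (φ₂ w).val 1 = 0
        rw [(hval w).2.1, h0]
        simp
      · show (φ₂ w).val 2 = 0
        rw [(hval w).2.2.1, h0]
        rfl
      · show (φ₂ w).val 3 = 0
        rw [(hval w).2.2.2, h0]
        rfl
    · rw [hHj]
      exact (cornerFaces_logic (hA' w' hw') (hB' w' hw') (hC' w' hw') (hD' w' hw')).1
    · rw [hHl]
      exact (cornerFaces_logic (hA' w' hw') (hB' w' hw') (hC' w' hw') (hD' w' hw')).2
  · exact absurd ⟨hPj, hNj⟩ hnot_j

end Summit.SmoothPoincare4.SmoothPoincare4.Theorems
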